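import Summits.BirchSwinnertonDyer.Rank1Residual.P2.CongruentNumberSilentEvenFiveEnclosureMaximal
import Summits.BirchSwinnertonDyer.Rank1Residual.P2.CongruentNumberSilentEvenFiveEnclosureRungTwoMaximal
import Literature.NumberTheory.EllipticCurves.Tian2014.CMPointSystemBridgeCusp
import HarnessLib

/-!
# Cell «bsd-monsky» (typer): THE ENCLOSURE RELATIVE TO THE CUSP SYSTEM FACT — C-P2-1 from ONE `2`-Selmer input
# (`hAo` Aoki 1999 Thm. 2.2 | `hMe` Heath-Brown 1994 | `h515` Monsky 1990) and `tian2014_system_sMinus_cusp`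
# (the maximal system fact with display M7 «`2·ϕ([i][0]) = 0`» replaced by TYZ's uniformisation `τ` and its two
# printed sentences «`τ(1/2) = [0]`», «`ϕ_F` and `[1+i]` have the same kernel `{0, τ(1)}`»); the whole even-five
# two-prime family and the `k = 2` rung of C-P2-2 from the same fact set

HONEST FRAMING: nothing asserted; conditional on the displayed fact `hSys⁵` (`Tian2014.tian2014_system_sMinus_cusp`) and on
ONE `2`-Selmer input (plus U⁺ / GZK for the family and rung statements). Compared with the maximal form
(`…EnclosureMaximal.lean`, p410425), the computed sentence `2·ϕ([i][0]) = 0` (M7, the fourth mark of referee B ROUND 253) is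
no longer displayed: it is the kernel theorem `CMPointData.BridgeData.TauData.phiIotaCuspTwoTorsion_of_tauDisplays` of
«`τ(1/2) = [0]`» (TYZ §3.2, J741) and Lemma 3.16's «the same kernel `{0, τ(1)}`» (J754). One-line compositions through
`tian2014_system_sMinus_maximal_of_cusp`; nothing booked.
-/

noncomputable section

open scoped Classical

open WeierstrassCurve Literature.NumberTheory.EllipticCurves
  Literature.NumberTheory.EllipticCurves.Monsky1990
  Literature.NumberTheory.EllipticCurves.Rank1Residual.Typed

set_option autoImplicit false

namespace Summit.BirchSwinnertonDyer.Rank1Residual.P2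

open Conjectures Literature.NumberTheory.EllipticCurves.Tian2014
  Literature.NumberTheory.EllipticCurves.HeathBrown1994
  Literature.NumberTheory.EllipticCurves.Aoki1999
  Literature.NumberTheory.EllipticCurves.Rank1Residual
  Literature.NumberTheory.EllipticCurves.TianYuanZhang2017

/-! ## §1 C-P2-1 on `𝒮⁻` from the cusp system fact and one `2`-Selmer input -/

/-- **C-P2-1 relative to Aoki 1999's Selmer count and the CUSP system fact** (no Cor 5.15, no HB94, no assembled point
identification, no computed cusp sentence). Sorry-free; nothing asserted. [cite: Aoki1999, Thm. 2.2 p. 81]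
[cite: Tian2014, Thm. 2.8 (J132), Def. 2.7, Prop. 2.1] [cite: TianYuanZhang2017, Thm. 3.3 (p. 739), p. 749, J741, J747, J751, Lemma 3.16 (J754)]
[cite: Miller2011LMS, Def. 1.1] -/
theorem congruentSilentEvenFiveBSDTwo_of_cuspSystem_of_aoki (hAo : thm22_card_selmerGroup_two)
    (hSys : tian2014_system_sMinus_cusp) : CongruentSilentEvenFiveBSDTwo :=
  congruentSilentEvenFiveBSDTwo_of_maximalSystem_of_aoki hAo (tian2014_system_sMinus_maximal_of_cusp hSys)

/-- **C-P2-1, `ord` form, relative to Aoki 1999's Selmer count and the CUSP system fact.** Sorry-free; nothing asserted.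
[cite: Aoki1999, Thm. 2.2 p. 81] [cite: Tian2014, Thm. 2.8 (J132), Def. 2.7, Prop. 2.1]
[cite: TianYuanZhang2017, Thm. 3.3 (p. 739), p. 749, J741, J747, J751, Lemma 3.16 (J754)] -/
theorem congruentSilentEvenFiveOrdTwo_of_cuspSystem_of_aoki (hAo : thm22_card_selmerGroup_two)
    (hSys : tian2014_system_sMinus_cusp) : CongruentSilentEvenFiveOrdTwo :=
  congruentSilentEvenFiveOrdTwo_of_maximalSystem_of_aoki hAo (tian2014_system_sMinus_maximal_of_cusp hSys)

/-- **C-P2-1 relative to Heath-Brown 1994's Selmer count and the CUSP system fact.** Sorry-free; nothing asserted.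
[cite: HeathBrown1994SelmerCongruentII, Appendix (Monsky)] [cite: Tian2014, Thm. 2.8 (J132), Def. 2.7, Prop. 2.1]
[cite: TianYuanZhang2017, Thm. 3.3 (p. 739), p. 749, J741, J747, J751, Lemma 3.16 (J754)] [cite: Miller2011LMS, Def. 1.1] -/
theorem congruentSilentEvenFiveBSDTwo_of_cuspSystem_of_monskyEven (hMe : monsky_card_selmerGroup_two_even)
    (hSys : tian2014_system_sMinus_cusp) : CongruentSilentEvenFiveBSDTwo :=
  congruentSilentEvenFiveBSDTwo_of_maximalSystem_of_monskyEven hMe (tian2014_system_sMinus_maximal_of_cusp hSys)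

/-- **C-P2-1 relative to Monsky 1990 Cor. 5.15 and the CUSP system fact.** Sorry-free; nothing asserted.
[cite: Monsky1990MockHeegner, Cor. 5.15 (p. 66), Remark (2) (p. 67)] [cite: Tian2014, Thm. 2.8 (J132), Def. 2.7, Prop. 2.1]
[cite: TianYuanZhang2017, Thm. 3.3 (p. 739), p. 749, J741, J747, J751, Lemma 3.16 (J754)] [cite: Miller2011LMS, Def. 1.1] -/
theorem congruentSilentEvenFiveBSDTwo_of_cuspSystem
    (h515 : cor515_rank_eq_one_and_card_selmerGroup_two) (hSys : tian2014_system_sMinus_cusp) :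
    CongruentSilentEvenFiveBSDTwo :=
  congruentSilentEvenFiveBSDTwo_of_maximalSystem h515 (tian2014_system_sMinus_maximal_of_cusp hSys)

/-! ## §2 The whole even-five two-prime family, no Rédei–Reichardt binder -/

/-- **`BSD(E_{2pq}, 2)` for ALL primes `p ≡ 5 (mod 8)`, `q ≡ 3 (mod 4)` from `{hTYZ, hGZK, hAo, hSys⁵}`** — TYZ §3
data, GZK, Aoki's refereed count and the cusp system fact; no Monsky 1990, no Heath-Brown 1994, no Rédei–Reichardt
binder, no assembled or computed sentence. Conditional; nothing asserted.
[cite: TianYuanZhang2017, Thm. 1.2, Thm. 3.3, Thm. 3.5 and §1 (1.1), J741, Lemma 3.16 (J754)] [cite: Aoki1999, Thm. 2.2 p. 81]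
[cite: Tian2014, Thm. 2.8 (J132), Def. 2.7, Prop. 2.1] [cite: Miller2011LMS, Def. 1.1] -/
theorem forall_bsdp_two_congruentNumberCurve_two_mul_five_mul_of_cuspSystem_of_aoki
    (hTYZ : tyz_genusPointData) (hGZK : rank_eq_analyticRank_of_analyticRank_le_one)
    (hAo : thm22_card_selmerGroup_two) (hSys : tian2014_system_sMinus_cusp) :
    ∀ p q : ℕ, p.Prime → q.Prime → p % 8 = 5 → q % 4 = 3 →
      BSDp (congruentNumberCurve (2 * (p * q))) 2 :=
  forall_bsdp_two_congruentNumberCurve_two_mul_five_mul_of_maximalSystem_of_aoki hTYZ hGZK hAo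
    (tian2014_system_sMinus_maximal_of_cusp hSys)

/-- **`BSD(E_{2pq}, 2)` for ALL primes `p ≡ 5 (mod 8)`, `q ≡ 3 (mod 4)` from `{hTYZ, hGZK, hMe, hSys⁵}`.** Conditional;
nothing asserted. [cite: TianYuanZhang2017, Thm. 1.2, Thm. 3.3, Thm. 3.5 and §1 (1.1), J741, Lemma 3.16 (J754)]
[cite: HeathBrown1994SelmerCongruentII, Appendix (Monsky)] [cite: Tian2014, Thm. 2.8 (J132), Def. 2.7, Prop. 2.1] [cite: Miller2011LMS, Def. 1.1] -/
theorem forall_bsdp_two_congruentNumberCurve_two_mul_five_mul_of_cuspSystem_of_monskyEven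
    (hTYZ : tyz_genusPointData) (hGZK : rank_eq_analyticRank_of_analyticRank_le_one)
    (hMe : monsky_card_selmerGroup_two_even) (hSys : tian2014_system_sMinus_cusp) :
    ∀ p q : ℕ, p.Prime → q.Prime → p % 8 = 5 → q % 4 = 3 →
      BSDp (congruentNumberCurve (2 * (p * q))) 2 :=
  forall_bsdp_two_congruentNumberCurve_two_mul_five_mul_of_maximalSystem_of_monskyEven hTYZ hGZK hMe
    (tian2014_system_sMinus_maximal_of_cusp hSys)

/-! ## §3 The `k = 2` rung of C-P2-2 from the cusp system fact and Aoki's count -/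

/-- **THE SILENT `k = 2` RUNG from {`hAo`, `hSys⁵`}.** Conditional; nothing asserted.
[cite: Aoki1999, Thm. 2.2 p. 81] [cite: Tian2014, Thm. 2.8 (J132), Def. 2.7, Prop. 2.1] [cite: TianYuanZhang2017, J741, Lemma 3.16 (J754)]
[cite: Monsky1990MockHeegner, Remark (3) (p. 67)] -/
theorem congruentSilentEvenBSDTwoAt_two_of_cuspSystem_of_aoki (hAo : thm22_card_selmerGroup_two)
    (hSys : tian2014_system_sMinus_cusp) : CongruentSilentEvenBSDTwoAt 2 :=
  congruentSilentEvenBSDTwoAt_two_of_maximalSystem_of_aoki hAo (tian2014_system_sMinus_maximal_of_cusp hSys)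

/-- **THE `k = 2` RUNG `CongruentEvenBSDTwoAt 2` from {U⁺, GZK, `hAo`, `hSys⁵`}.** Conditional; nothing asserted.
[cite: Aoki1999, Thm. 2.2 p. 81] [cite: TianYuanZhang2017, Thm. 1.2, Thm. 3.3, Thm. 3.5, J741, Lemma 3.16 (J754)]
[cite: Tian2014, Thm. 2.8 (J132), Def. 2.7, Prop. 2.1] [cite: Monsky1990MockHeegner, Remark (3) (p. 67)] [cite: Miller2011LMS, Def. 1.1] -/
theorem congruentEvenBSDTwoAt_two_of_cuspSystem_of_aoki
    (hU : ∀ (n : ℕ), Squarefree n → (n % 8 = 5 ∨ n % 8 = 6 ∨ n % 8 = 7) →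
      ∃ L : ℤ, IsScriptL n L ∧
        ((n % 8 = 5 ∨ n % 8 = 7) → (2 : ℤ) ∣ L →
          Even (genusSum₁ n fun d => genusClassNumber (GenusField d)) ∧
          Even (genusSum₂' n fun d => genusClassNumber (GenusField d))) ∧
        (n % 8 = 6 → (2 : ℤ) ∣ L → Even (genusSum₂' n fun d => genusClassNumber (GenusField d))))
    (hGZK : rank_eq_analyticRank_of_analyticRank_le_one) (hAo : thm22_card_selmerGroup_two)
    (hSys : tian2014_system_sMinus_cusp) : CongruentEvenBSDTwoAt 2 :=
  congruentEvenBSDTwoAt_two_of_maximalSystem_of_aoki hU hGZK hAo (tian2014_system_sMinus_maximal_of_cusp hSys)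

/-- **THE `k = 2` RUNG, SHARPER FORM `CongruentEvenOrdTwoAt 2` from {U⁺, GZK, `hAo`, `hSys⁵`}.** Conditional;
nothing asserted. [cite: Aoki1999, Thm. 2.2 p. 81] [cite: TianYuanZhang2017, §1 (1.1), Thm. 3.3, J741, Lemma 3.16 (J754)]
[cite: Tian2014, Def. 2.7, Prop. 2.1] [cite: Monsky1990MockHeegner, Remark (3) (p. 67)] -/
theorem congruentEvenOrdTwoAt_two_of_cuspSystem_of_aoki
    (hU : ∀ (n : ℕ), Squarefree n → (n % 8 = 5 ∨ n % 8 = 6 ∨ n % 8 = 7) →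
      ∃ L : ℤ, IsScriptL n L ∧
        ((n % 8 = 5 ∨ n % 8 = 7) → (2 : ℤ) ∣ L →
          Even (genusSum₁ n fun d => genusClassNumber (GenusField d)) ∧
          Even (genusSum₂' n fun d => genusClassNumber (GenusField d))) ∧
        (n % 8 = 6 → (2 : ℤ) ∣ L → Even (genusSum₂' n fun d => genusClassNumber (GenusField d))))
    (hGZK : rank_eq_analyticRank_of_analyticRank_le_one) (hAo : thm22_card_selmerGroup_two)
    (hSys : tian2014_system_sMinus_cusp) : CongruentEvenOrdTwoAt 2 :=
  congruentEvenOrdTwoAt_two_of_maximalSystem_of_aoki hU hGZK hAo (tian2014_system_sMinus_maximal_of_cusp hSys)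

end Summit.BirchSwinnertonDyer.Rank1Residual.P2

end
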